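import Summits.PneNP.PneNP.Theorems.PseudorandomTwinsAbove.Negative.RegularTests

/-!
# Route PhaseTwins, crux `PseudorandomTwinsAbove` (stmt-PneNP-2721) — negative side: setwise merging is merging in total variation

Continuation of `Negative/FalseWithoutPolyTime.lean` and `Negative/RegularTests.lean` (crux
stmt-PneNP-2721, `Summit.PneNP.PneNP.Theses.PhaseTwins.PseudorandomTwinsAbove`; disprover's work
file `Summits/PneNP/PneNP/Cruxes/PseudorandomTwinsAbove/Disproof.lean`, cycle 2).

* `setwise_merge_uniform` (Phillips' lemma / the Schur property of `ℓ¹`, for probability mass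
  functions on an arbitrary type): if `|P n (S) − Q n (S)| → 0` for EVERY set `S`, then the
  convergence is uniform in `S`, i.e. the total variation distance of `P n` and `Q n` tends to
  `0`. Gliding hump: otherwise there are sets `S_k` with discrepancy `> ε` along `n_k → ∞`, and
  disjoint finite humps `F_k ⊆ S_k` whose union `T` keeps discrepancy `≥ ε/2` at every `n_k`.
  This supersedes the cycle-1 lemma `no_setwise_indistinguishable_far_pair` (disjointly
  concentrated pairs have total variation `→ 1`).
* `tv_merge_of_unbounded_tests`: hence clause (i) of the crux WITHOUT the time bound on the
  tests says exactly that `D₀ n` and `D₁ n` are statistically indistinguishable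
  (`sup_S |D₀ n S − D₁ n S| → 0`) — the index-free unbounded test class is as strong as the
  index-fed one; all content of the crux is in the time bound (cycle 1) and nothing is lost by
  the missing index at the information-theoretic level.
* `lengthLaws_tv_merge`: for the TYPED crux, the length laws of any witness merge in total
  variation: `sup_{T ⊆ ℕ} |D₀ n (|x| ∈ T) − D₁ n (|x| ∈ T)| → 0` (length-set tests
  `lengthSet_merge` + Phillips). A witness may as well be thought of as having identical length
  laws on the YES and NO sides.
-/

namespace Summit.PneNP.PneNP.Theorems.PseudorandomTwinsAbove.Negative

open Literature.Computability.Complexity Literature.Computability.MetaComplexity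
open Filter Topology
open scoped ENNReal

noncomputable section

variable {X : Type*}

/-- Additivity of mass on disjoint finite sets. [folklore] -/
theorem mass_finset_union (p : PMF X) {A B : Finset X} [DecidableEq X] (h : Disjoint A B) :
    (PMF.toOuterMeasure p ↑(A ∪ B)).toReal =
      (PMF.toOuterMeasure p ↑A).toReal + (PMF.toOuterMeasure p ↑B).toReal := by
  rw [mass_finset, mass_finset, mass_finset, Finset.sum_union h]

/-- The signed discrepancy of a sub-finset is at most the pointwise discrepancy of the finset.
[folklore] -/
theorem sub_le_pointwise (p q : PMF X) {A Φ : Finset X} (h : A ⊆ Φ) :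
    (PMF.toOuterMeasure p ↑A).toReal - (PMF.toOuterMeasure q ↑A).toReal ≤
      ∑ x ∈ Φ, |(PMF.toOuterMeasure p {x}).toReal - (PMF.toOuterMeasure q {x}).toReal| := by
  rw [mass_finset, mass_finset, ← Finset.sum_sub_distrib]
  simp only [mass_singleton]
  calc ∑ x ∈ A, ((p x).toReal - (q x).toReal) ≤ ∑ x ∈ A, |(p x).toReal - (q x).toReal| :=
        Finset.sum_le_sum fun x _ => le_abs_self _
    _ ≤ ∑ x ∈ Φ, |(p x).toReal - (q x).toReal| :=
        Finset.sum_le_sum_of_subset_of_nonneg h fun _ _ _ => abs_nonneg _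

/-- PHILLIPS' LEMMA (Schur property of `ℓ¹`) for probability mass functions: setwise merging
`|P n (S) − Q n (S)| → 0` for every `S` is already UNIFORM in `S` (total variation `→ 0`).
Gliding hump. [folklore] -/
theorem setwise_merge_uniform (P Q : ℕ → PMF X)
    (h : ∀ S : Set X, Tendsto (fun n => |(PMF.toOuterMeasure (P n) S).toReal -
      (PMF.toOuterMeasure (Q n) S).toReal|) atTop (𝓝 0))
    {ε : ℝ} (hε : 0 < ε) :
    ∀ᶠ n in atTop, ∀ S : Set X,
      |(PMF.toOuterMeasure (P n) S).toReal - (PMF.toOuterMeasure (Q n) S).toReal| ≤ ε := by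
  classical
  by_contra hcon
  simp only [not_eventually, not_forall, not_le] at hcon
  -- WLOG the discrepancy is positive (pass to the complement otherwise)
  have hfreq : ∃ᶠ n in atTop, ∃ S : Set X,
      ε < (PMF.toOuterMeasure (P n) S).toReal - (PMF.toOuterMeasure (Q n) S).toReal := by
    refine hcon.mono fun n ⟨S, hS⟩ => ?_
    rcases le_or_gt 0 ((PMF.toOuterMeasure (P n) S).toReal - (PMF.toOuterMeasure (Q n) S).toReal)
      with hpos | hneg
    · exact ⟨S, by rwa [abs_of_nonneg hpos] at hS⟩
    · refine ⟨Sᶜ, ?_⟩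
      rw [abs_of_neg hneg] at hS
      have h1 := mass_add_compl (P n) S
      have h2 := mass_add_compl (Q n) S
      linarith
  -- pointwise discrepancy on a finite set
  set d : ℕ → Finset X → ℝ := fun n Φ => ∑ x ∈ Φ, |(PMF.toOuterMeasure (P n) {x}).toReal -
    (PMF.toOuterMeasure (Q n) {x}).toReal| with hd
  have hd_tendsto : ∀ Φ : Finset X, Tendsto (fun n => d n Φ) atTop (𝓝 0) := by
    intro Φ
    have h' := tendsto_finsetSum Φ (fun x (_ : x ∈ Φ) => h {x})
    simpa [hd] using h'
  set δ : ℝ := ε / 8 with hδ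
  have hδpos : 0 < δ := by positivity
  -- good indices exist beyond any bound
  have hstep : ∀ (m : ℕ) (Φ : Finset X), ∃ n, m < n ∧ d n Φ ≤ δ ∧ ∃ S : Set X,
      ε < (PMF.toOuterMeasure (P n) S).toReal - (PMF.toOuterMeasure (Q n) S).toReal := by
    intro m Φ
    have e1 := (hd_tendsto Φ).eventually_lt_const hδpos
    obtain ⟨n, hnS, hnm, hnd⟩ := (hfreq.and_eventually ((eventually_gt_atTop m).and e1)).exists
    exact ⟨n, hnm, hnd.le, hnS⟩
  -- two-sided tightness at every index
  have htight : ∀ n, ∃ E : Finset X, (PMF.toOuterMeasure (P n) ((↑E)ᶜ)).toReal ≤ δ ∧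
      (PMF.toOuterMeasure (Q n) ((↑E)ᶜ)).toReal ≤ δ := by
    intro n
    obtain ⟨E₁, h₁⟩ := exists_finset_mass_compl_le (P n) hδpos
    obtain ⟨E₂, h₂⟩ := exists_finset_mass_compl_le (Q n) hδpos
    refine ⟨E₁ ∪ E₂, ?_, ?_⟩
    · refine (mass_mono _ (Set.compl_subset_compl.2 ?_)).trans h₁
      rw [Finset.coe_union]; exact Set.subset_union_left
    · refine (mass_mono _ (Set.compl_subset_compl.2 ?_)).trans h₂
      rw [Finset.coe_union]; exact Set.subset_union_right
  -- the recursion: state = (last index, union of all finite sets used so far)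
  let nOf : ℕ × Finset X → ℕ := fun s => Classical.choose (hstep s.1 s.2)
  have nOf_spec : ∀ s : ℕ × Finset X, s.1 < nOf s ∧ d (nOf s) s.2 ≤ δ ∧ ∃ S : Set X,
      ε < (PMF.toOuterMeasure (P (nOf s)) S).toReal - (PMF.toOuterMeasure (Q (nOf s)) S).toReal :=
    fun s => Classical.choose_spec (hstep s.1 s.2)
  let SOf : ℕ × Finset X → Set X := fun s => Classical.choose (nOf_spec s).2.2
  have SOf_spec : ∀ s : ℕ × Finset X, ε < (PMF.toOuterMeasure (P (nOf s)) (SOf s)).toReal -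
      (PMF.toOuterMeasure (Q (nOf s)) (SOf s)).toReal :=
    fun s => Classical.choose_spec (nOf_spec s).2.2
  let EOf : ℕ × Finset X → Finset X := fun s => Classical.choose (htight (nOf s))
  have EOf_spec : ∀ s : ℕ × Finset X,
      (PMF.toOuterMeasure (P (nOf s)) ((↑(EOf s))ᶜ)).toReal ≤ δ ∧
        (PMF.toOuterMeasure (Q (nOf s)) ((↑(EOf s))ᶜ)).toReal ≤ δ :=
    fun s => Classical.choose_spec (htight (nOf s))
  let st : ℕ → ℕ × Finset X := fun k => Nat.rec (0, ∅) (fun _ s => (nOf s, s.2 ∪ EOf s)) k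
  let nk : ℕ → ℕ := fun k => nOf (st k)
  let Φk : ℕ → Finset X := fun k => (st k).2
  let Ek : ℕ → Finset X := fun k => EOf (st k)
  let Sk : ℕ → Set X := fun k => SOf (st k)
  let Fk : ℕ → Finset X := fun k => ((Ek k).filter (fun x => x ∈ Sk k)) \ Φk k
  have Φ_succ : ∀ k, Φk (k + 1) = Φk k ∪ Ek k := fun k => rfl
  have nk_strictMono : StrictMono nk := by
    refine strictMono_nat_of_lt_succ fun k => ?_
    exact (nOf_spec (st (k + 1))).1
  have Φ_mono : Monotone Φk :=
    monotone_nat_of_le_succ fun k => by rw [Φ_succ]; exact Finset.subset_union_left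
  have E_sub_Φ : ∀ {j k : ℕ}, j < k → Ek j ⊆ Φk k := by
    intro j k hjk
    have h1 : Ek j ⊆ Φk (j + 1) := by rw [Φ_succ]; exact Finset.subset_union_right
    exact h1.trans (Φ_mono (Nat.succ_le_of_lt hjk))
  have F_sub_E : ∀ k, Fk k ⊆ Ek k := fun k => Finset.sdiff_subset.trans (Finset.filter_subset _ _)
  have F_sub_Sk : ∀ k, (↑(Fk k) : Set X) ⊆ Sk k := by
    intro k x hx
    have hx' := Finset.mem_sdiff.1 (Finset.mem_coe.1 hx)
    exact (Finset.mem_filter.1 hx'.1).2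
  have F_disj_Φ : ∀ k, Disjoint (Fk k) (Φk k) := fun k => Finset.sdiff_disjoint
  -- the single set
  let T : Set X := ⋃ k, (↑(Fk k) : Set X)
  have F_sub_T : ∀ k, (↑(Fk k) : Set X) ⊆ T := fun k =>
    Set.subset_iUnion (fun k => (↑(Fk k) : Set X)) k
  have T_sub : ∀ k, T ⊆ (↑(Fk k) ∪ ↑((Φk k).filter (fun x => x ∈ T))) ∪ (↑(Ek k))ᶜ := by
    intro k x hx
    obtain ⟨j, hj⟩ := Set.mem_iUnion.1 hx
    rcases lt_trichotomy j k with hjk | rfl | hkj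
    · exact Or.inl (Or.inr (Finset.mem_coe.2 (Finset.mem_filter.2
        ⟨E_sub_Φ hjk (F_sub_E j (Finset.mem_coe.1 hj)), hx⟩)))
    · exact Or.inl (Or.inl hj)
    · refine Or.inr fun hxE => ?_
      have hxΦ : x ∈ Φk j := E_sub_Φ hkj (Finset.mem_coe.1 hxE)
      exact Finset.disjoint_left.1 (F_disj_Φ j) (Finset.mem_coe.1 hj) hxΦ
  -- discrepancy estimates at stage k
  have hgap : ∀ k, ε / 2 ≤ (PMF.toOuterMeasure (P (nk k)) T).toReal -
      (PMF.toOuterMeasure (Q (nk k)) T).toReal := by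
    intro k
    have hdΦ : d (nk k) (Φk k) ≤ δ := (nOf_spec (st k)).2.1
    have hS : ε < (PMF.toOuterMeasure (P (nk k)) (Sk k)).toReal -
        (PMF.toOuterMeasure (Q (nk k)) (Sk k)).toReal := SOf_spec (st k)
    have hPE : (PMF.toOuterMeasure (P (nk k)) ((↑(Ek k))ᶜ)).toReal ≤ δ := (EOf_spec (st k)).1
    have hQE : (PMF.toOuterMeasure (Q (nk k)) ((↑(Ek k))ᶜ)).toReal ≤ δ := (EOf_spec (st k)).2
    -- the hump carries discrepancy ≥ ε − 2δ
    set ΦS : Finset X := (Φk k).filter (fun x => x ∈ Sk k) with hΦS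
    have hΦS_sub : ΦS ⊆ Φk k := Finset.filter_subset _ _
    have hF_disj_ΦS : Disjoint (Fk k) ΦS := (F_disj_Φ k).mono_right hΦS_sub
    have hSk_sub : Sk k ⊆ (↑(Fk k) ∪ ↑ΦS) ∪ (↑(Ek k))ᶜ := by
      intro x hxS
      by_cases hxE : x ∈ Ek k
      · by_cases hxΦ : x ∈ Φk k
        · exact Or.inl (Or.inr (Finset.mem_coe.2 (Finset.mem_filter.2 ⟨hxΦ, hxS⟩)))
        · exact Or.inl (Or.inl (Finset.mem_coe.2
            (Finset.mem_sdiff.2 ⟨Finset.mem_filter.2 ⟨hxE, hxS⟩, hxΦ⟩)))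
      · exact Or.inr fun h' => hxE (Finset.mem_coe.1 h')
    have hunion_sub_S : (↑(Fk k ∪ ΦS) : Set X) ⊆ Sk k := by
      rw [Finset.coe_union]
      exact Set.union_subset (F_sub_Sk k) fun x hx => (Finset.mem_filter.1 (Finset.mem_coe.1 hx)).2
    have hPS : (PMF.toOuterMeasure (P (nk k)) (Sk k)).toReal ≤
        (PMF.toOuterMeasure (P (nk k)) ↑(Fk k)).toReal + (PMF.toOuterMeasure (P (nk k)) ↑ΦS).toReal
          + (PMF.toOuterMeasure (P (nk k)) ((↑(Ek k))ᶜ)).toReal := by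
      calc (PMF.toOuterMeasure (P (nk k)) (Sk k)).toReal
          ≤ (PMF.toOuterMeasure (P (nk k)) ((↑(Fk k) ∪ ↑ΦS) ∪ (↑(Ek k))ᶜ)).toReal :=
            mass_mono _ hSk_sub
        _ ≤ (PMF.toOuterMeasure (P (nk k)) (↑(Fk k) ∪ ↑ΦS)).toReal +
            (PMF.toOuterMeasure (P (nk k)) ((↑(Ek k))ᶜ)).toReal := mass_union_le _ _ _
        _ ≤ _ := by
            have h'' := mass_union_le (P (nk k)) ↑(Fk k) ↑ΦS
            linarith
    have hQS : (PMF.toOuterMeasure (Q (nk k)) ↑(Fk k)).toReal +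
        (PMF.toOuterMeasure (Q (nk k)) ↑ΦS).toReal ≤ (PMF.toOuterMeasure (Q (nk k)) (Sk k)).toReal := by
      rw [← mass_finset_union (Q (nk k)) hF_disj_ΦS]
      exact mass_mono _ hunion_sub_S
    have hΦS_d : (PMF.toOuterMeasure (P (nk k)) ↑ΦS).toReal -
        (PMF.toOuterMeasure (Q (nk k)) ↑ΦS).toReal ≤ δ :=
      (sub_le_pointwise (P (nk k)) (Q (nk k)) hΦS_sub).trans hdΦ
    have hhump : ε - 2 * δ ≤ (PMF.toOuterMeasure (P (nk k)) ↑(Fk k)).toReal -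
        (PMF.toOuterMeasure (Q (nk k)) ↑(Fk k)).toReal := by
      linarith
    -- the set T at stage k
    set ΦT : Finset X := (Φk k).filter (fun x => x ∈ T) with hΦT
    have hΦT_sub : ΦT ⊆ Φk k := Finset.filter_subset _ _
    have hF_disj_ΦT : Disjoint (Fk k) ΦT := (F_disj_Φ k).mono_right hΦT_sub
    have hunion_sub_T : (↑(Fk k ∪ ΦT) : Set X) ⊆ T := by
      rw [Finset.coe_union]
      exact Set.union_subset (F_sub_T k) fun x hx => (Finset.mem_filter.1 (Finset.mem_coe.1 hx)).2
    have hQT : (PMF.toOuterMeasure (Q (nk k)) T).toReal ≤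
        (PMF.toOuterMeasure (Q (nk k)) ↑(Fk k)).toReal + (PMF.toOuterMeasure (Q (nk k)) ↑ΦT).toReal
          + (PMF.toOuterMeasure (Q (nk k)) ((↑(Ek k))ᶜ)).toReal := by
      calc (PMF.toOuterMeasure (Q (nk k)) T).toReal
          ≤ (PMF.toOuterMeasure (Q (nk k)) ((↑(Fk k) ∪ ↑ΦT) ∪ (↑(Ek k))ᶜ)).toReal :=
            mass_mono _ (T_sub k)
        _ ≤ (PMF.toOuterMeasure (Q (nk k)) (↑(Fk k) ∪ ↑ΦT)).toReal +
            (PMF.toOuterMeasure (Q (nk k)) ((↑(Ek k))ᶜ)).toReal := mass_union_le _ _ _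
        _ ≤ _ := by
            have h'' := mass_union_le (Q (nk k)) ↑(Fk k) ↑ΦT
            linarith
    have hPT : (PMF.toOuterMeasure (P (nk k)) ↑(Fk k)).toReal +
        (PMF.toOuterMeasure (P (nk k)) ↑ΦT).toReal ≤ (PMF.toOuterMeasure (P (nk k)) T).toReal := by
      rw [← mass_finset_union (P (nk k)) hF_disj_ΦT]
      exact mass_mono _ hunion_sub_T
    have hΦT_d : (PMF.toOuterMeasure (Q (nk k)) ↑ΦT).toReal -
        (PMF.toOuterMeasure (P (nk k)) ↑ΦT).toReal ≤ δ := by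
      have h' := sub_le_pointwise (Q (nk k)) (P (nk k)) hΦT_sub
      have hd' : ∑ x ∈ Φk k, |(PMF.toOuterMeasure (Q (nk k)) {x}).toReal -
          (PMF.toOuterMeasure (P (nk k)) {x}).toReal| = d (nk k) (Φk k) := by
        simp only [hd]
        exact Finset.sum_congr rfl fun x _ => abs_sub_comm _ _
      linarith
    have hδε : δ = ε / 8 := hδ
    linarith
  -- contradiction with the hypothesis on T along the subsequence nk
  have hlim : Tendsto (fun k => |(PMF.toOuterMeasure (P (nk k)) T).toReal -
      (PMF.toOuterMeasure (Q (nk k)) T).toReal|) atTop (𝓝 0) :=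
    (h T).comp nk_strictMono.tendsto_atTop
  obtain ⟨k, hk⟩ := (hlim.eventually_lt_const (show (0 : ℝ) < ε / 2 by positivity)).exists
  have := hgap k
  linarith [le_abs_self ((PMF.toOuterMeasure (P (nk k)) T).toReal -
    (PMF.toOuterMeasure (Q (nk k)) T).toReal)]

/-- CLAUSE (i) WITHOUT THE TIME BOUND IS STATISTICAL INDISTINGUISHABILITY. If every
`RandAlg (List Bool) Bool` (index-free, computationally unbounded) has vanishing advantage, then
`sup_S |D₀ n (S) − D₁ n (S)| → 0`: the deterministic indicator tests give setwise merging
(`tsum_indicatorTest_eq_mass`), and Phillips' lemma makes it uniform. So the index-free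
unbounded test class loses nothing against the index-fed one at the information-theoretic level;
all content of the crux sits in the time bound (cf. `pseudorandomTwinsAbove_false_without_polyTime`).
[this work] -/
theorem tv_merge_of_unbounded_tests (D₀ D₁ : Ensemble)
    (hind : ∀ A : RandAlg (List Bool) Bool, Tendsto (fun n : ℕ =>
      |(∑' x : List Bool, ((D₀ n) x).toReal * A.pr id x {b | b = true}) -
        (∑' x : List Bool, ((D₁ n) x).toReal * A.pr id x {b | b = true})|) atTop (𝓝 0))
    {ε : ℝ} (hε : 0 < ε) :
    ∀ᶠ n in atTop, ∀ S : Set (List Bool), |D₀.prob n S - D₁.prob n S| ≤ ε := by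
  classical
  refine setwise_merge_uniform D₀ D₁ (fun S => ?_) hε
  have h' := hind (RandAlg.ofDet fun x => decide (x ∈ S))
  simp only [tsum_indicatorTest_eq_mass] at h'
  exact h'

/-- FOR THE TYPED CRUX THE LENGTH LAWS MERGE IN TOTAL VARIATION: for every witness pair and
every `ε > 0`, eventually `|D₀ n (|x| ∈ T) − D₁ n (|x| ∈ T)| ≤ ε` for ALL `T ⊆ ℕ` simultaneously
(`lengthSet_merge` + Phillips' lemma on the push-forwards to `ℕ`). [this work] -/
theorem lengthLaws_tv_merge (D₀ D₁ : Ensemble)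
    (hind : ∀ A : RandAlg (List Bool) Bool,
      A.IsPolyTime (id : List Bool → List Bool) Computability.encodeBool →
      Tendsto (fun n : ℕ => |(∑' x : List Bool, ((D₀ n) x).toReal * A.pr id x {b | b = true}) -
        (∑' x : List Bool, ((D₁ n) x).toReal * A.pr id x {b | b = true})|) atTop (𝓝 0))
    {ε : ℝ} (hε : 0 < ε) :
    ∀ᶠ n in atTop, ∀ T : Set ℕ,
      |D₀.prob n {x | x.length ∈ T} - D₁.prob n {x | x.length ∈ T}| ≤ ε := by
  have hmap : ∀ (D : PMF (List Bool)) (S : Set ℕ),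
      (PMF.toOuterMeasure (D.map List.length) S).toReal =
        (PMF.toOuterMeasure D {x | x.length ∈ S}).toReal := by
    intro D S
    rw [PMF.toOuterMeasure_map_apply]
    rfl
  have h := setwise_merge_uniform (fun n => (D₀ n).map List.length)
    (fun n => (D₁ n).map List.length) (fun S => ?_) hε
  · simp only [hmap] at h
    exact h
  · simp only [hmap]
    exact lengthSet_merge D₀ D₁ hind S

end

end Summit.PneNP.PneNP.Theorems.PseudorandomTwinsAbove.Negative
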